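import Summits.HubbardSuperconductivity.HubbardSuperconductivity.Theses.WeakCouplingBCS
import Summits.HubbardSuperconductivity.HubbardSuperconductivity.Theses.KacWindowPenalty
import Summits.HubbardSuperconductivity.HubbardSuperconductivity.Theorems.WeakCouplingBCSWcbcsSsbToTorusLROFejerClosure
import Literature.MathematicalPhysics.QuantumLattice.PairFieldMomentum
import Literature.MathematicalPhysics.QuantumLattice.PairCorrelationsProofs
import Literature.MathematicalPhysics.QuantumLattice.ApproximateEigenvectorLemmas
import Summits.HubbardSuperconductivity.HubbardSuperconductivity.Theorems.BalabanIRBirEveryGroundStateSchur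

/-!
# Line `tangent-face-legendre-spine` — checked skeleton for crux `WcbcsSsbToTorusLRO`
(stmt-HubbardSuperconductivity-2009; lead prover's copy, rebuilt 2026-08-15 from the registered stub
signatures because the planner's `Lines/tangent-face-legendre-spine.lean` was never published to the tree)

RESHAPE v2 (2026-08-16, after wave 1): `stub_fejerClosure` LANDED (p72085,
`Theorems/WeakCouplingBCSWcbcsSsbToTorusLROFejerClosure.lean`) and is now imported; `stub_infraredLeak` is
implied outright by the EXISTING open crux `KacWindowPenalty.WindowInfraredBound` (stmt-HubbardSuperconductivity-1089,
wanted by routes KacWindowPenalty rank 3 / FunctionFieldCertificate rank 4) — proved below as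
`infraredLeak_of_windowInfraredBound` — so it is no longer a stub: the skeleton theorem takes that route item BY
NAME as its one admissible hypothesis. ONE stub remains: `stub_facePurityChord` (held by the lead).

Crux: `∃ U₀ > 0, ∀ U ∈ Ioo 0 U₀, ∀ δ ∈ Ioo 0 (1/2), ∀ μ, DensityMatched U δ μ → HasDWaveOrder U μ →
HasDWavePairFieldLROAt U δ`.

Line (card `Ideas/tangent-face-legendre-spine.md`): read SSB ⇒ torus LRO through the Fejér identity
`LRO_L = [block pair coherence at scale R] − [pair weight at momenta 0 < |q| < η] − [UV tail ≤ 2π²C²/(R²η²)]`: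

* `stub_facePurityChord` (P, OPEN, hardest): from the crux hypotheses, the LEFT chord of the sector energy of
  the Kac-block-REPELLED model `H_U + κ R⁻⁴ Σ_a B_aᴴ B_a` (`B_a = Σ_{u ∈ [0,R)²} P_{a+u}`) is extensive:
  `κ a L² ≤ E_sec(H + κ R⁻⁴ Σ B_aᴴB_a) − E_sec(H)` eventually along even sides, with `a > 0` uniform in `R`
  (face purity at scale `R`; every-GS is then free by the finite-`L` chord inequality).
* `stub_infraredLeak` (IR_Σ, OPEN): every normalised sector ground state has small pair weight on the
  punctured infrared window: `L⁻² Σ_{0<|q_m|<η} S_ψ(m) ≤ b` for `η = η(b)`.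
* `stub_fejerClosure` (provable now): the finite Fourier inequality closing the two into zero-momentum LRO.
* `WcbcsSsbToTorusLRO_of` (sorry-free): chord inequality (`chord_div_le_re_expect_of_eigen`) turns (P)
  into block coherence `≥ a` of EVERY admissible ground state, (IR_Σ) with `b = a/4`, `R` chosen with
  tail `≤ a/4`, Fejér gives `Re⟨P†P⟩ ≥ (a/2)·L⁴` eventually, and the §K kernel `evenLRO_of_eventually_le`
  (re-proved here) gives the summit matrix.

Disproof used (Cruxes/WcbcsSsbToTorusLRO/Disproof.lean gen 2): §K (`evenLRO_of_eventually_le`,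
`re_expect_pairField_le` — verbatim); §2 (no `_false_without_` theorem exists; both crux hypotheses are
consumed inside `stub_facePurityChord`); §4 (the uniform `∃U₀ ∀δ` form is kept since the stubs mirror the
crux; `CruxSwapped` is the free fallback); §8 (`griffithsSandwich` is a tree corollary, not a stub).
-/

noncomputable section

set_option linter.dupNamespace false

namespace Summit.HubbardSuperconductivity.HubbardSuperconductivity.Cruxes.WcbcsSsbToTorusLRO.TangentFaceLegendreSpine

open Literature.MathematicalPhysics.QuantumLattice Literature.Barriers.HubbardSuperconductivity
open Literature.Probability.LatticeModels
open Summit.HubbardSuperconductivity.HubbardSuperconductivity.Theorems (chord_div_le_re_expect_of_eigen)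
open Filter Set
open scoped Matrix ComplexOrder BigOperators
open _root_.Topology

/-! ## The registered stub (v2: one left) and the discharged ones -/

/-- **Stub (P) — face purity, chord form (OPEN, hardest).** Under the crux hypotheses, adding the
positive, U(1)-invariant Kac-block pair repulsion `κ R⁻⁴ Σ_a B_aᴴ B_a` raises the `(N_L, S^z=0)`-sector
ground energy of `hubbardTorus 2 L 1 U` by at least `κ a L²` along the even sides, with `a > 0` uniform
in the block scale `R` (the coupling `κ` may depend on `R`). -/
theorem stub_facePurityChord :
    ∃ U₀ : ℝ, 0 < U₀ ∧ ∀ U ∈ Set.Ioo (0:ℝ) U₀, ∀ δ ∈ Set.Ioo (0:ℝ) (1 / 2), ∀ μ : ℝ, Filter.Tendsto (fun L : ℕ => ((hubbardTorusWith 2 (L + 1) 1 U μ).groundStateFunctional totalNumber).re / ((L + 1 : ℕ) : ℝ) ^ 2) Filter.atTop (nhds (1 - δ)) → HasDWaveOrder U μ → ∃ a : ℝ, 0 < a ∧ ∀ R : ℕ, 0 < R → ∃ κ : ℝ, 0 < κ ∧ ∀ᶠ k : ℕ in Filter.atTop, κ * a * ((2 * k + 1 + 1 : ℕ) : ℝ)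 ^ 2 ≤ (hubbardTorus 2 (2 * k + 1 + 1) 1 U + (κ : ℂ) • ((((R : ℝ) ^ 4)⁻¹ : ℝ) : ℂ) • ∑ a : TorusSite 2 (2 * k + 1 + 1), (∑ u : Fin 2 → Fin R, localPair dWaveFormFactor (2 * k + 1 + 1) (a + fun i => ((u i : ℕ) : ZMod (2 * k + 1 + 1))))ᴴ * (∑ u : Fin 2 → Fin R, localPair dWaveFormFactor (2 * k + 1 + 1) (a + fun i => ((u i : ℕ) : ZMod (2 * k + 1 + 1))))).minEnergyOn (szSector (2 * ⌊(1 - δ) * ((2 * k + 1 + 1 : ℕ) : ℝ) ^ 2 / 2⌋₊) 0) - (hubbardTorus 2 (2 * k + 1 + 1) 1 U).minEnergyOn (szSector (2 * ⌊(1 - δ) * ((2 * k + 1 + 1 : ℕ) : ℝ) ^ 2 / 2⌋₊) 0) := by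
  sorry

/-- **(IR_Σ) from the existing item `KacWindowPenalty.WindowInfraredBound` (stmt-HubbardSuperconductivity-1089).**
The window infrared bound `L⁻² Σ_{m≠0,|q_m|≤ε} ‖Δ_d(m)ψ‖² ≤ C ε L²` (every `U > 0`, `δ ∈ (0,1/2)`, even
`L ≥ L₀`, every normalised sector ground state) gives the line's infrared-leak statement with window
`η := min ε₀ (b/(C+1))`; the two grand-canonical crux hypotheses are not used (they carry no finite-`L`
information about canonical sector ground states). Its `let D` is `pairFieldAt dWaveFormFactor L` by `rfl`. -/
theorem infraredLeak_of_windowInfraredBound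
    (hW : Summit.HubbardSuperconductivity.HubbardSuperconductivity.Theses.KacWindowPenalty.WindowInfraredBound) :
    ∃ U₀ : ℝ, 0 < U₀ ∧ ∀ U ∈ Set.Ioo (0:ℝ) U₀, ∀ δ ∈ Set.Ioo (0:ℝ) (1 / 2), ∀ μ : ℝ, Filter.Tendsto (fun L : ℕ => ((hubbardTorusWith 2 (L + 1) 1 U μ).groundStateFunctional totalNumber).re / ((L + 1 : ℕ) : ℝ) ^ 2) Filter.atTop (nhds (1 - δ)) → HasDWaveOrder U μ → ∀ b : ℝ, 0 < b → ∃ η : ℝ, 0 < η ∧ ∀ᶠ k : ℕ in Filter.atTop, ∀ ψ : Fock (Orb (FermionTorus 2 (2 * k + 1 + 1))), IsGroundStateInSector (hubbardTorus 2 (2 * k + 1 + 1) 1 U) (2 * ⌊(1 - δ) * ((2 * k + 1 + 1 : ℕ) : ℝ) ^ 2 / 2⌋₊) 0 ψ → star ψ ⬝ᵥ ψ = 1 → (∑ m ∈ (Finset.univ.filter fun m : TorusSite 2 (2 * k + 1 + 1) => m ≠ 0 ∧ momentumNormSq (2 * k + 1 + 1) m < η ^ 2), pairStructureFactor dWaveFormFactor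 (2 * k + 1 + 1) ψ m) / ((2 * k + 1 + 1 : ℕ) : ℝ) ^ 2 ≤ b := by
  refine ⟨1, one_pos, fun U hU δ hδ _μ _ _ b hb => ?_⟩
  obtain ⟨C, ε₀, hC, hε₀, L₀, hW⟩ := hW U hU.1 δ hδ
  have hC1 : 0 < C + 1 := by linarith
  set η : ℝ := min ε₀ (b / (C + 1)) with hη_def
  have hη : 0 < η := lt_min hε₀ (div_pos hb hC1)
  have hηε : η ∈ Set.Ioc (0:ℝ) ε₀ := ⟨hη, min_le_left _ _⟩
  have hCη : C * η ≤ b := by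
    have h1 : η ≤ b / (C + 1) := min_le_right _ _
    have h2 : C * η ≤ C * (b / (C + 1)) := mul_le_mul_of_nonneg_left h1 hC
    have h3 : C * (b / (C + 1)) ≤ b := by
      rw [mul_div_assoc', div_le_iff₀ hC1]; nlinarith
    exact h2.trans h3
  refine ⟨η, hη, ?_⟩
  filter_upwards [Filter.eventually_ge_atTop L₀] with k hk
  intro ψ hGS hnorm
  have hL₀ : L₀ ≤ 2 * k + 1 + 1 := by omega
  have hEven : Even (2 * k + 1 + 1) := ⟨k + 1, by ring⟩
  have key := hW η hηε (2 * k + 1 + 1) hL₀ hEven ψ hnorm hGS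
  have key' : (∑ m : TorusSite 2 (2 * k + 1 + 1),
      if m ≠ 0 ∧ momentumNormSq (2 * k + 1 + 1) m ≤ η ^ 2 then
        pairStructureFactor dWaveFormFactor (2 * k + 1 + 1) ψ m else 0) ≤
      C * η * ((2 * k + 1 + 1 : ℕ) : ℝ) ^ 2 := key
  have hsub : (Finset.univ.filter fun m : TorusSite 2 (2 * k + 1 + 1) =>
        m ≠ 0 ∧ momentumNormSq (2 * k + 1 + 1) m < η ^ 2) ⊆
      (Finset.univ.filter fun m : TorusSite 2 (2 * k + 1 + 1) =>
        m ≠ 0 ∧ momentumNormSq (2 * k + 1 + 1) m ≤ η ^ 2) := by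
    intro m
    simp only [Finset.mem_filter, Finset.mem_univ, true_and]
    exact fun hm => ⟨hm.1, hm.2.le⟩
  have hle := Finset.sum_le_sum_of_subset_of_nonneg hsub
    (fun m _ _ => pairStructureFactor_nonneg dWaveFormFactor (2 * k + 1 + 1) ψ m)
  replace hle := hle.trans_eq (Finset.sum_filter _ _)
  have hLpos : (0 : ℝ) < ((2 * k + 1 + 1 : ℕ) : ℝ) ^ 2 := by positivity
  rw [div_le_iff₀ hLpos]
  calc _ ≤ _ := hle
    _ ≤ C * η * ((2 * k + 1 + 1 : ℕ) : ℝ) ^ 2 := key'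
    _ ≤ b * ((2 * k + 1 + 1 : ℕ) : ℝ) ^ 2 := mul_le_mul_of_nonneg_right hCη hLpos.le

/-! ## The finite-volume kernel (Disproof §K, verbatim) -/

section Kernel

variable (g : Site 2 → ℝ)

/-- The a priori constant `C_g = 2 Σ_e |g e|/√2` of `pairFieldCorr_succ_le`. -/
def corrConst : ℝ :=
  ∑ e ∈ insert (0 : Site 2) unitSteps, ‖((g e / Real.sqrt 2 : ℝ) : ℂ)‖ * 2

/-- A priori bound: `Re⟨ψ, P†P ψ⟩ ≤ C_g² (L+1)⁴` for a normalised state. -/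
theorem re_expect_pairField_le (ψ : ∀ L, Fock (Orb (FermionTorus 2 L))) (L : ℕ)
    (hψ : star (ψ (L + 1)) ⬝ᵥ ψ (L + 1) = 1) :
    (expect ((pairField g (L + 1))ᴴ * pairField g (L + 1)) (ψ (L + 1))).re ≤
      corrConst g ^ 2 * ((L + 1 : ℕ) : ℝ) ^ 4 := by
  rw [← sum_pairFieldCorr_succ]
  calc ∑ x : TorusSite 2 (L + 1), ∑ y, pairFieldCorr g ψ (L + 1) x y
      ≤ ∑ x : TorusSite 2 (L + 1), ∑ y : TorusSite 2 (L + 1), corrConst g ^ 2 :=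
        Finset.sum_le_sum fun x _ => Finset.sum_le_sum fun y _ => pairFieldCorr_succ_le g ψ L hψ x y
    _ = corrConst g ^ 2 * ((L + 1 : ℕ) : ℝ) ^ 4 := by
        simp only [Finset.sum_const, Finset.card_univ, Fintype.card_pi, ZMod.card,
          Finset.prod_const, Fintype.card_fin]
        push_cast
        ring

/-- **Even-side LRO from an eventual floor** (Disproof §K): normalisation and
`a·(2k+2)⁴ ≤ Re⟨ψ_{2k+2}, P†P ψ_{2k+2}⟩` eventually, `a > 0`, give the summit's even-side LRO. -/
theorem evenLRO_of_eventually_le (ψ : ∀ L, Fock (Orb (FermionTorus 2 L))) {a : ℝ} (ha : 0 < a)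
    (hnorm : ∀ᶠ k : ℕ in atTop, star (ψ (2 * k + 1 + 1)) ⬝ᵥ ψ (2 * k + 1 + 1) = 1)
    (hlow : ∀ᶠ k : ℕ in atTop, a * ((2 * k + 1 + 1 : ℕ) : ℝ) ^ 4 ≤
      (expect ((pairField g (2 * k + 1 + 1))ᴴ * pairField g (2 * k + 1 + 1))
        (ψ (2 * k + 1 + 1))).re) :
    HasLongRangeOrder (fun k => halfOpenBox 2 (2 * k))
      (fun k => torusPullback (pairFieldCorr g ψ) (2 * k)) := by
  unfold HasLongRangeOrder
  rw [← Filter.liminf_nat_add _ 1]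
  have key : ∀ k : ℕ,
      (∑ x ∈ halfOpenBox 2 (2 * (k + 1)), ∑ y ∈ halfOpenBox 2 (2 * (k + 1)),
          torusPullback (pairFieldCorr g ψ) (2 * (k + 1)) x y) /
        ((halfOpenBox 2 (2 * (k + 1))).card : ℝ) ^ 2 =
      (expect ((pairField g (2 * k + 1 + 1))ᴴ * pairField g (2 * k + 1 + 1))
          (ψ (2 * k + 1 + 1))).re / ((2 * k + 1 + 1 : ℕ) : ℝ) ^ 4 := by
    intro k
    rw [show 2 * (k + 1) = 2 * k + 1 + 1 by ring]
    exact torusLROSeq_pairFieldCorr_succ g ψ (2 * k + 1)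
  simp only [key]
  have hpos : ∀ k : ℕ, (0 : ℝ) < ((2 * k + 1 + 1 : ℕ) : ℝ) ^ 4 := fun k => by positivity
  refine lt_of_lt_of_le ha (le_liminf_of_le ?_ ?_)
  · refine isCoboundedUnder_ge_of_eventually_le _ (x := corrConst g ^ 2) ?_
    filter_upwards [hnorm] with k hk
    rw [div_le_iff₀ (hpos k)]
    exact re_expect_pairField_le g ψ (2 * k + 1) hk
  · filter_upwards [hlow] with k hk
    rwa [le_div_iff₀ (hpos k)]

end Kernel

/-! ## Composition -/

/-- Real part of `⟨ψ, (c • Σ_a M_aᴴ M_a) ψ⟩` is `c · Re Σ_a ⟨M_a ψ, M_a ψ⟩`. -/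
theorem re_expect_smul_sum_conjTranspose_mul {n : Type*} [Fintype n] {ι : Type*} (s : Finset ι)
    (M : ι → Matrix n n ℂ) (c : ℝ) (ψ : n → ℂ) :
    (star ψ ⬝ᵥ (((c : ℂ) • ∑ a ∈ s, (M a)ᴴ * M a) *ᵥ ψ)).re =
      c * (∑ a ∈ s, star (M a *ᵥ ψ) ⬝ᵥ (M a *ᵥ ψ)).re := by
  rw [Matrix.smul_mulVec, dotProduct_smul, smul_eq_mul, Complex.re_ofReal_mul, Matrix.sum_mulVec,
    dotProduct_sum]
  congr 2
  refine Finset.sum_congr rfl fun a _ => ?_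
  rw [star_mulVec_dotProduct_mulVec]

/-- A natural block scale making the UV tail small: `2π²C²/(R²η²) ≤ a/4` for some `R ≥ 1`. -/
theorem exists_blockScale (C : ℝ) {a η : ℝ} (ha : 0 < a) (hη : 0 < η) :
    ∃ R : ℕ, 0 < R ∧ 2 * Real.pi ^ 2 * C ^ 2 / ((R : ℝ) ^ 2 * η ^ 2) ≤ a / 4 := by
  obtain ⟨R, hR⟩ := exists_nat_gt (max (8 * Real.pi ^ 2 * C ^ 2 / (a * η ^ 2)) 1)
  have hR1 : (1 : ℝ) < R := lt_of_le_of_lt (le_max_right _ _) hR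
  have hRX : 8 * Real.pi ^ 2 * C ^ 2 / (a * η ^ 2) < R := lt_of_le_of_lt (le_max_left _ _) hR
  have hRpos : 0 < R := by exact_mod_cast (zero_lt_one.trans hR1)
  refine ⟨R, hRpos, ?_⟩
  have hR2 : (R : ℝ) ≤ (R : ℝ) ^ 2 := by nlinarith
  have hX : 8 * Real.pi ^ 2 * C ^ 2 ≤ a * η ^ 2 * (R : ℝ) ^ 2 := by
    rw [div_lt_iff₀ (by positivity)] at hRX
    nlinarith [mul_pos ha (pow_pos hη 2)]
  rw [div_le_div_iff₀ (by positivity) (by norm_num : (0:ℝ) < 4)]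
  nlinarith

/-- **Composition (body form).** Face purity (P), infrared leak (IR_Σ) and the Fejér closure (F) imply the
body of the crux (spelled out, so that only `WcbcsSsbToTorusLRO_of` below concludes the crux by name). -/
theorem crux_body_of_face_leak_fejer
    (hP : ∃ U₀ : ℝ, 0 < U₀ ∧ ∀ U ∈ Set.Ioo (0:ℝ) U₀, ∀ δ ∈ Set.Ioo (0:ℝ) (1 / 2), ∀ μ : ℝ, Filter.Tendsto (fun L : ℕ => ((hubbardTorusWith 2 (L + 1) 1 U μ).groundStateFunctional totalNumber).re / ((L + 1 : ℕ) : ℝ) ^ 2) Filter.atTop (nhds (1 - δ)) → HasDWaveOrder U μ → ∃ a : ℝ, 0 < a ∧ ∀ R : ℕ, 0 < R → ∃ κ : ℝ, 0 < κ ∧ ∀ᶠ k : ℕ in Filter.atTop, κ * a * ((2 * k + 1 + 1 : ℕ) : ℝ) ^ 2 ≤ (hubbardTorus 2 (2 * k + 1 + 1) 1 U + (κ : ℂ) • ((((R : ℝ) ^ 4)⁻¹ : ℝ) : ℂ) • ∑ a : TorusSite 2 (2 * k + 1 + 1), (∑ u : Fin 2 → Fin R, localPair dWaveFormFactor (2 *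 k + 1 + 1) (a + fun i => ((u i : ℕ) : ZMod (2 * k + 1 + 1))))ᴴ * (∑ u : Fin 2 → Fin R, localPair dWaveFormFactor (2 * k + 1 + 1) (a + fun i => ((u i : ℕ) : ZMod (2 * k + 1 + 1))))).minEnergyOn (szSector (2 * ⌊(1 - δ) * ((2 * k + 1 + 1 : ℕ) : ℝ) ^ 2 / 2⌋₊) 0) - (hubbardTorus 2 (2 * k + 1 + 1) 1 U).minEnergyOn (szSector (2 * ⌊(1 - δ) * ((2 * k + 1 + 1 : ℕ) : ℝ) ^ 2 / 2⌋₊) 0))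
    (hIR : ∃ U₀ : ℝ, 0 < U₀ ∧ ∀ U ∈ Set.Ioo (0:ℝ) U₀, ∀ δ ∈ Set.Ioo (0:ℝ) (1 / 2), ∀ μ : ℝ, Filter.Tendsto (fun L : ℕ => ((hubbardTorusWith 2 (L + 1) 1 U μ).groundStateFunctional totalNumber).re / ((L + 1 : ℕ) : ℝ) ^ 2) Filter.atTop (nhds (1 - δ)) → HasDWaveOrder U μ → ∀ b : ℝ, 0 < b → ∃ η : ℝ, 0 < η ∧ ∀ᶠ k : ℕ in Filter.atTop, ∀ ψ : Fock (Orb (FermionTorus 2 (2 * k + 1 + 1))), IsGroundStateInSector (hubbardTorus 2 (2 * k + 1 + 1) 1 U) (2 * ⌊(1 - δ) * ((2 * k + 1 + 1 : ℕ) : ℝ) ^ 2 / 2⌋₊) 0 ψ → star ψ ⬝ᵥ ψ = 1 → (∑ m ∈ (Finset.univ.filter fun m : TorusSite 2 (2 * k + 1 + 1) => m ≠ 0 ∧ momentumNormSq (2 * k + 1 + 1) m < η ^ 2), pairStructureFactor dWaveFormFactor (2 * k + 1 + 1) ψ m) / ((2 * k + 1 + 1 : ℕ) : ℝ) ^ 2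 ≤ b)
    (hF : ∀ (g : Site 2 → ℝ) (L : ℕ) [NeZero L] (R : ℕ), 0 < R → ∀ η : ℝ, 0 < η → ∀ ψ : Fock (Orb (FermionTorus 2 L)), star ψ ⬝ᵥ ψ = 1 → (∑ a : TorusSite 2 L, star ((∑ u : Fin 2 → Fin R, localPair g L (a + fun i => ((u i : ℕ) : ZMod L))) *ᵥ ψ) ⬝ᵥ ((∑ u : Fin 2 → Fin R, localPair g L (a + fun i => ((u i : ℕ) : ZMod L))) *ᵥ ψ)).re / ((R : ℝ) ^ 4 * (L : ℝ) ^ 2) - (∑ m ∈ (Finset.univ.filter fun m : TorusSite 2 L => m ≠ 0 ∧ momentumNormSq L m < η ^ 2), pairStructureFactor g L ψ m) / (L : ℝ) ^ 2 - 2 * Real.pi ^ 2 * (∑ e ∈ insert (0 : Site 2) unitSteps, ‖((g e / Real.sqrt 2 : ℝ) : ℂ)‖ * 2) ^ 2 / ((R : ℝ) ^ 2 * η ^ 2) ≤ (expect ((pairField g L)ᴴ * pairField g L) ψ).re / (L : ℝ) ^ 4) :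
    ∃ U₀ : ℝ, 0 < U₀ ∧ ∀ U ∈ Set.Ioo (0:ℝ) U₀, ∀ δ ∈ Set.Ioo (0:ℝ) (1 / 2), ∀ μ : ℝ, Filter.Tendsto (fun L : ℕ => ((hubbardTorusWith 2 (L + 1) 1 U μ).groundStateFunctional totalNumber).re / ((L + 1 : ℕ) : ℝ) ^ 2) Filter.atTop (nhds (1 - δ)) → HasDWaveOrder U μ → HasDWavePairFieldLROAt U δ := by
  obtain ⟨UP, hUP, hP⟩ := hP
  obtain ⟨UI, hUI, hIR⟩ := hIR
  refine ⟨min UP UI, lt_min hUP hUI, fun U hU δ hδ μ hdm hord => ?_⟩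
  have hUP' : U ∈ Set.Ioo (0:ℝ) UP := ⟨hU.1, lt_of_lt_of_le hU.2 (min_le_left _ _)⟩
  have hUI' : U ∈ Set.Ioo (0:ℝ) UI := ⟨hU.1, lt_of_lt_of_le hU.2 (min_le_right _ _)⟩
  -- (P): the block coherence floor `a`
  obtain ⟨a, ha, hPa⟩ := hP U hUP' δ hδ μ hdm hord
  -- (IR_Σ) with budget `a/4`: the window `η`
  obtain ⟨η, hη, hIRη⟩ := hIR U hUI' δ hδ μ hdm hord (a / 4) (by positivity)
  -- the block scale `R` with UV tail ≤ a/4, then the coupling `κ`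
  set C : ℝ := ∑ e ∈ insert (0 : Site 2) unitSteps, ‖((dWaveFormFactor e / Real.sqrt 2 : ℝ) : ℂ)‖ * 2
    with hC_def
  obtain ⟨R, hR, htail⟩ := exists_blockScale C ha hη
  obtain ⟨κ, hκ, hPk⟩ := hPa R hR
  -- the admissible sequence
  intro N ψ hadm
  refine evenLRO_of_eventually_le dWaveFormFactor ψ (a := a / 2) (by positivity)
    (Eventually.of_forall fun k => (hadm (2 * k + 1 + 1) ⟨k + 1, by ring⟩).2.1) ?_
  filter_upwards [hPk, hIRη] with k hPk hIRk
  set L : ℕ := 2 * k + 1 + 1 with hL_def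
  obtain ⟨hNL, hnorm, hGS⟩ := hadm L ⟨k + 1, by simp [hL_def]; ring⟩
  rw [hNL] at hGS
  set K := szSector (Λ := FermionTorus 2 L) (2 * ⌊(1 - δ) * ((L : ℕ) : ℝ) ^ 2 / 2⌋₊) 0 with hK_def
  set B : TorusSite 2 L → Matrix (Finset (Orb (FermionTorus 2 L))) (Finset (Orb (FermionTorus 2 L))) ℂ :=
    fun a => ∑ u : Fin 2 → Fin R, localPair dWaveFormFactor L (a + fun i => ((u i : ℕ) : ZMod L))
    with hB_def
  set Y : Matrix (Finset (Orb (FermionTorus 2 L))) (Finset (Orb (FermionTorus 2 L))) ℂ :=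
    ((((R : ℝ) ^ 4)⁻¹ : ℝ) : ℂ) • ∑ a : TorusSite 2 L, (B a)ᴴ * B a with hY_def
  -- (1) chord inequality for the admissible ground state
  have hchord := chord_div_le_re_expect_of_eigen (hubbardTorus 2 L 1 U) Y K hκ hGS.1 hnorm hGS.2.2
  have hblock : a * ((L : ℕ) : ℝ) ^ 2 ≤ (star (ψ L) ⬝ᵥ Y *ᵥ ψ L).re := by
    have h1 : κ * a * ((L : ℕ) : ℝ) ^ 2 ≤
        (hubbardTorus 2 L 1 U + (κ : ℂ) • Y).minEnergyOn K - (hubbardTorus 2 L 1 U).minEnergyOn K := hPk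
    rw [div_le_iff₀ hκ] at hchord
    nlinarith
  have hY : (star (ψ L) ⬝ᵥ Y *ᵥ ψ L).re =
      ((R : ℝ) ^ 4)⁻¹ * (∑ a : TorusSite 2 L, star (B a *ᵥ ψ L) ⬝ᵥ (B a *ᵥ ψ L)).re :=
    re_expect_smul_sum_conjTranspose_mul Finset.univ B _ (ψ L)
  -- (2) the infrared leak and (3) the Fejér closure
  have hleak := hIRk (ψ L) hGS hnorm
  have hfejer := hF dWaveFormFactor L R hR η hη (ψ L) hnorm
  have hLpos : (0 : ℝ) < ((L : ℕ) : ℝ) := by positivity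
  have hRpos : (0 : ℝ) < (R : ℝ) := by exact_mod_cast hR
  -- block coherence per R⁴L² is ≥ a
  have hb : a ≤ (∑ a : TorusSite 2 L, star (B a *ᵥ ψ L) ⬝ᵥ (B a *ᵥ ψ L)).re /
      ((R : ℝ) ^ 4 * ((L : ℕ) : ℝ) ^ 2) := by
    rw [le_div_iff₀ (by positivity)]
    rw [hY] at hblock
    have e : ((R : ℝ) ^ 4)⁻¹ * (∑ a : TorusSite 2 L, star (B a *ᵥ ψ L) ⬝ᵥ (B a *ᵥ ψ L)).re * (R : ℝ) ^ 4 =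
        (∑ a : TorusSite 2 L, star (B a *ᵥ ψ L) ⬝ᵥ (B a *ᵥ ψ L)).re := by
      field_simp
    nlinarith [mul_le_mul_of_nonneg_right hblock (pow_pos hRpos 4).le]
  have hfloor : a / 2 ≤ (expect ((pairField dWaveFormFactor L)ᴴ * pairField dWaveFormFactor L) (ψ L)).re /
      ((L : ℕ) : ℝ) ^ 4 := by
    linarith
  rwa [le_div_iff₀ (by positivity)] at hfloor

/-- **The skeleton theorem (v2)**: the one remaining stub `stub_facePurityChord`, the EXISTING route item
`KacWindowPenalty.WindowInfraredBound` (stmt-HubbardSuperconductivity-1089, admissible hypothesis by name) and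
the LANDED Fejér closure close the crux `WcbcsSsbToTorusLRO` BY NAME (the only `sorry` is in
`stub_facePurityChord`). -/
theorem WcbcsSsbToTorusLRO_of
    (hW : Summit.HubbardSuperconductivity.HubbardSuperconductivity.Theses.KacWindowPenalty.WindowInfraredBound) :
    Summit.HubbardSuperconductivity.HubbardSuperconductivity.Theses.WeakCouplingBCS.WcbcsSsbToTorusLRO :=
  crux_body_of_face_leak_fejer stub_facePurityChord (infraredLeak_of_windowInfraredBound hW)
    (fun g L _ R hR η hη ψ hψ =>
      Summit.HubbardSuperconductivity.HubbardSuperconductivity.Theorems.WcbcsSsbToTorusLRO.stub_fejerClosure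
        g L R hR η hη ψ hψ)

end Summit.HubbardSuperconductivity.HubbardSuperconductivity.Cruxes.WcbcsSsbToTorusLRO.TangentFaceLegendreSpine

end
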